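import Literature.IUT.HodgeArakelov.MonoThetaProjectiveProp15ivHullProofs
import Literature.IUT.HodgeArakelov.MonoThetaProjectiveNaturalSystemBridge
import Literature.IUT.HodgeArakelov.MonoThetaProjectiveThetaEnvProofs
import Literature.IUT.HodgeArakelov.ModelCyclotomesZHat
import Literature.IUT.HodgeArakelov.EtaleThetaDataOfSettingCor218i

/-!
# [IUTchII] Prop. 1.5 (iv) at the GENUINE natural system with the object binders `hZ` / `hchar` / `hlim` / `hΔ`
# DISCHARGED by name — the instance form modulo FACT-LIST rows and the `Π_X`-side root binder `hYcl` (proof-only)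

PROOF-ONLY companion (theorems only: no `def`, no `instance`, no new named fact, nothing restated), abc-iut cell,
wave W6, seat abc-iut-w6-d004 gen 2, DAG node **IUTchII:Prop1.5(iv)**; sequel to this seat's
`MonoThetaProjectiveProp15ivProofs.lean` (p429231: clause "compatible with the Kummer-theoretic construction of the
étale theta function") and `MonoThetaProjectiveProp15ivHullProofs.lean` (p432317: clause "compatible with the Kummer
theory of the base-field-theoretic hull").  S. Mochizuki, *Inter-universal Teichmüller theory II*, kurims manuscript
(Dec. 2020), §1, Prop. 1.5 (iv), p. 30 l. 18–26 [claim: Mochizuki2012, status: disputed] (IUTchII §1 Prop 1.5 (iv),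
kurims p.30); [EtTh] = S. Mochizuki, *The étale theta function …*, Publ. RIMS **45** (2009), §1 p. 238 "`Δ_Θ (≅ Ẑ(1))`",
Cor. 2.18 (i) p. 286, Cor. 2.19 p. 290 [cite: MochizukiEtTh2009, Cor 2.19 (ii) p.64].

Those two files state the node for abc-iut-w5-d233's `T := EtaleLevels.thetaEnvDataNatural … hZ hchar hlim` with the
natural system's OBJECT binders left as hypotheses: `hZ` ("`(l·Δ_Θ)(𝕄_M) ≅ Ẑ`"), `hchar` (`PiYddCharacteristic`, F-2633),
`hlim` ("`(l·Δ_Θ) ⥲ lim_M μ_M`") and, for the hull clause, `hΔ` (`IsCompact Δ_Θ`).  Every one of them is a THEOREM of the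
tree modulo FACT-LIST rows and the ONE `Π_X`-side root binder `hYcl` (GAP-LEDGER G-w4d021-2, verbatim):
* `hZ` ⟸ abc-iut-L2-d1 `ModelCyclotomes.nonempty_lDeltaQuot_rigidData_mulEquiv_zHat` (p415192 chain; `IsEtThOrigin` F-2498 + `hYcl`);
* `hlim` ⟸ abc-iut-w4-d030 `EtaleLevels.bijective_rigidLimHom` (p416249, from `hZ`) through abc-iut-w5-d233's bridge
  `bijective_rigidLimHom_iff_bijective_toMuLim`;
* `hchar` ⟸ abc-iut-w4-d013 `EtaleThetaDataOfSetting.piYddCharacteristic_of_cor218_i` ([EtTh] Cor. 2.18 (i) at the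
  model's rigidity data, `RigidData.Cor218_i`, FACT-LIST F-0620);
* `hΔ` ⟸ abc-iut-w5-d111 `ThetaSetting.isCompact_deltaTheta_of_groupLevelData` (p425959; `hYcl` + the §6 tempered
  parameter bundle `GroupLevelData`).
THIS FILE performs the substitution: `EtaleLevels.hZ_of_origin`, `hlim_toMuLim_of_origin` (the two object binders as
theorems), and **`EtaleLevels.prop15_iv_thetaEnvDataNatural_kummer_and_hull_of_origin`** — [IUTchII] Prop. 1.5 (iv),
both conclusions, at the genuine natural system, whose ONLY hypotheses beyond the [EtTh] §1–§2 data
(`C, hC, hS, hl, hp2, hpl, hζ, mods, hmods, f, hf, h15, L`, the Kummer input `TK`) are: `IsEtThOrigin` (F-2498),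
`RigidData.Cor218_i` at the level-`1` model (F-0620), `IsThetaKummer` (F-0565) + `ConstCompat` (F-0618), the §6 bundle
`GroupLevelData`, and `hYcl`.  HONEST FRAMING: plumbing over landed theorems; claim key `Mochizuki2012` DISPUTED
(D-0012); nothing here asserts a disputed claim or takes a side on [IUTchIII] Cor. 3.12; typed ≠ proved for the named
inputs; instantiated ≠ endorsed.
-/

noncomputable section

namespace Literature.IUT.HodgeArakelov

open Literature.AnabelianGeometry.EtaleTheta Literature.AnabelianGeometry.SemiGraphs
open CohomologySystemOfContH1 EtaleThetaDataOfSetting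

namespace EtaleLevels

variable {p : ℕ} [Fact p.Prime] {D : Literature.AnabelianGeometry.EtaleTheta.ThetaSetting p}
  {E : D.EtaleThetaData} {l : ℕ} (C : E.DoubleUnderline l) (hC : D.Compat) (hS : D.Sec2Hyps)
  (hl : l.Prime) (hp2 : p ≠ 2) (hpl : p ≠ l) (hζ : ∃ ζ : D.K, IsPrimitiveRoot ζ (4 * l))
  (mods : ∀ M : ℕ+, D.CyclotomeMod l M)
  (f : contCocycles D.toTheta D.DeltaTheta C.GtpYdduu) (hf : f ∈ C.rootCocycles hC)
  (hmods : ∀ (M M' : ℕ+) (h : (M : ℕ) ∣ (M' : ℕ)) (x : D.lDeltaTheta l),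
    MuN.red p M M' h ((mods M').red x) = (mods M).red x)
  (h15 : Literature.AnabelianGeometry.EtaleTheta.ThetaSetting.Prop15iii E hC) (L : C.CuspLabels)

include hl in
/-- **The binder `hZ` of the natural system is a theorem** under the origin guard and `hYcl`: every mod-`M` model's
interior cyclotome `(l·Δ_Θ)(𝕄_M) = (l·Δ_Θ)/thetaKer` is isomorphic to `Ẑ` (abc-iut-L2-d1, [EtTh] §1 "`Δ_Θ (≅ Ẑ(1))`").
[cite: MochizukiEtTh2009, §1 p.12] -/
theorem hZ_of_origin (hO : D.IsEtThOrigin)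
    (hYcl : (D.DtpY.map D.toHat.toMonoidHom).topologicalClosure ≤
      D.DtpY.map D.toHat.toMonoidHom ⊔ (⁅⁅D.DeltaHat, D.DeltaHat⁆, D.DeltaHat⁆).topologicalClosure) :
    ∀ M : ℕ+, Nonempty (ModelCyclotomes.lDeltaQuot (C.rigidData (mods M) hC hS h15 L) ≃*
      Literature.IUT.HodgeTheaters.ZHat) :=
  fun M => ModelCyclotomes.nonempty_lDeltaQuot_rigidData_mulEquiv_zHat C (mods M) hC hS h15 L hO hYcl hl.ne_zero

include hl hp2 hpl hζ f hf in
/-- **The binder `hlim` ("`(l·Δ_Θ) ⥲ lim_M μ_M`") of abc-iut-w5-d233's `thetaEnvDataNatural` is a theorem** under the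
origin guard and `hYcl`: abc-iut-w4-d030's `bijective_rigidLimHom` (from `hZ`) through the bridge
`bijective_rigidLimHom_iff_bijective_toMuLim`. [cite: MochizukiEtTh2009, §1 p.12] -/
theorem hlim_toMuLim_of_origin (hO : D.IsEtThOrigin)
    (hYcl : (D.DtpY.map D.toHat.toMonoidHom).topologicalClosure ≤
      D.DtpY.map D.toHat.toMonoidHom ⊔ (⁅⁅D.DeltaHat, D.DeltaHat⁆, D.DeltaHat⁆).topologicalClosure) :
    Function.Bijective (toMuLim C hC hS mods hmods h15 L) :=
  (bijective_rigidLimHom_iff_bijective_toMuLim C hC hS hl hp2 hpl hζ mods f hf hmods h15 L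
      (hZ_of_origin C hC hS hl mods h15 L hO hYcl)).1
    (bijective_rigidLimHom C hC hS hl hp2 hpl hζ mods f hf hmods h15 L (hZ_of_origin C hC hS hl mods h15 L hO hYcl))

/-- **[IUTchII] Prop. 1.5 (iv) at the GENUINE natural projective system of `X̲̲_K` — instance form with the object
binders discharged.** Hypotheses beyond the [EtTh] §1–§2 data and the Kummer input `TK`: the origin guard `hO`
(F-2498), the §6 tempered bundle `d` and the `Π_X`-side root binder `hYcl`, [EtTh] Cor. 2.18 (i) at the level-`1`
model's rigidity data (`h218`, F-0620), `IsThetaKummer` (F-0565) and `ConstCompat` (F-0618). Conclusion: that of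
`prop15_iv_thetaEnvDataNatural_kummer_and_hull` (p432317) for
`T := thetaEnvDataNatural … (hZ_of_origin …) (piYddCharacteristic_of_cor218_i …) (hlim_toMuLim_of_origin …)` — (a) a
unit `c₀` with `η̈^Θ = κ(c₀ · Θ̈)`, `l`-th roots of it exist, and for every such root `g` the transported θ-set `θ[g]`
satisfies `Prop15_iv_compatible T` (= equals `θ_env(M^Θ_*)`); (b) a bijective change of coefficient cyclotome with the
printed level formula which composed with `T.rigidLim` is the tautological `Λ(ℚ̄_pˣ) = Π_μ(M^Θ_*)`, along which the
hull's Kummer map into `T.cohEnv.lim` is injective, `Π^tp_X̲̲`-equivariant, with conjugation-stable images of the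
Galois-stable constant monoids. [claim: Mochizuki2012, status: disputed] (IUTchII §1 Prop 1.5 (iv), kurims p.30) -/
theorem prop15_iv_thetaEnvDataNatural_kummer_and_hull_of_origin (hO : D.IsEtThOrigin)
    (d : D.toTemperedCurve.GroupLevelData)
    (hYcl : (D.DtpY.map D.toHat.toMonoidHom).topologicalClosure ≤
      D.DtpY.map D.toHat.toMonoidHom ⊔ (⁅⁅D.DeltaHat, D.DeltaHat⁆, D.DeltaHat⁆).topologicalClosure)
    (h218 : (C.rigidData (mods 1) hC hS h15 L).Cor218_i)
    (TK : D.ThetaKummerInput) (hKum : E.IsThetaKummer TK) (hcc : TK.ConstCompat E.toKummerData) :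
    haveI := piYdd_normal C hC
    ∃ c₀ ∈ D.unitsOKdd, ∃ c : CyclotomeCoefficients (phi C) (D.lDeltaTheta l) (PadicAlgCl p)ˣ,
      (E.etaDd = TK.kummerConstMulTheta c₀ ∧
        (∃ (g : contCocycles D.toTheta D.DeltaTheta C.GtpYdduu) (_ : ∀ x, (g.1 x : D.GtpTheta) ∈ D.lDeltaTheta l),
          ContH1.mk g.1 g.2 = ContH1.res D.toTheta D.DeltaTheta inf_le_left (TK.kummerConstMulTheta c₀)) ∧
        ∀ (g : contCocycles D.toTheta D.DeltaTheta C.GtpYdduu) (hval : ∀ x, (g.1 x : D.GtpTheta) ∈ D.lDeltaTheta l),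
          ContH1.mk g.1 g.2 = ContH1.res D.toTheta D.DeltaTheta inf_le_left (TK.kummerConstMulTheta c₀) →
          Literature.IUT.HodgeArakelov.Prop15_iv_compatible
            (thetaEnvDataNatural C hC hS hl hp2 hpl hζ mods f hf hmods h15 L (hZ_of_origin C hC hS hl mods h15 L hO hYcl)
              (piYddCharacteristic_of_cor218_i C (mods 1) hC hS h15 L _ rfl h218)
              (hlim_toMuLim_of_origin C hC hS hl hp2 hpl hζ mods f hf hmods h15 L hO hYcl))
            ((thetaEnvDataNatural C hC hS hl hp2 hpl hζ mods f hf hmods h15 L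
                (hZ_of_origin C hC hS hl mods h15 L hO hYcl)
                (piYddCharacteristic_of_cor218_i C (mods 1) hC hS h15 L _ rfl h218)
                (hlim_toMuLim_of_origin C hC hS hl hp2 hpl hζ mods f hf hmods h15 L hO hYcl)).transportH1 ⊤ ''
              {b : (coh C).H1 ⊤ | ∃ σ : Pi C, l • (b + (h1Top C).symm (Additive.ofMul
                (ContH1.conj (phi C) (D.lDeltaTheta l) σ (rootClass C g hval)))) = 0})) ∧
      (Function.Bijective c.hom ∧
        (∀ (ζ : cyclotome (PadicAlgCl p)ˣ) (M : ℕ+),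
          (((mods M).red (c.hom ζ) : MuN p M) : (PadicAlgCl p)ˣ) = (ζ : ℕ+ → (PadicAlgCl p)ˣ) M) ∧
        (∀ (ζ : cyclotome (PadicAlgCl p)ˣ) (g : ↥((D.lDeltaTheta l).comap (D.toTheta.comp C.Huu.subtype))),
          C.toLDelta g = c.hom ζ →
            (thetaEnvDataNatural C hC hS hl hp2 hpl hζ mods f hf hmods h15 L (hZ_of_origin C hC hS hl mods h15 L hO hYcl)
                (piYddCharacteristic_of_cor218_i C (mods 1) hC hS h15 L _ rfl h218)
                (hlim_toMuLim_of_origin C hC hS hl hp2 hpl hζ mods f hf hmods h15 L hO hYcl)).rigidLim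
                (QuotientGroup.mk g : (EtaleThetaDataOfSetting.lDeltaSubquotient C).carrier) =
              muLimEquivExtCycLim C hC hS hl hp2 hpl hζ mods f hf hmods h15 L
                (hZ_of_origin C hC hS hl mods h15 L hO hYcl) ⟨_, tautological_mem_MuLim ζ⟩) ∧
        (∀ ζ : cyclotome (PadicAlgCl p)ˣ,
          ∃ g : ↥((D.lDeltaTheta l).comap (D.toTheta.comp C.Huu.subtype)), C.toLDelta g = c.hom ζ) ∧
        Function.Injective
          (h1LimKummer (phi C) (D.lDeltaTheta l) (PiYdd C) c (isOpen_stabilizer_units C) (finiteIndex_stabilizer_units C) :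
            (PadicAlgCl p)ˣ →*
              Multiplicative (thetaEnvDataNatural C hC hS hl hp2 hpl hζ mods f hf hmods h15 L
                (hZ_of_origin C hC hS hl mods h15 L hO hYcl)
                (piYddCharacteristic_of_cor218_i C (mods 1) hC hS h15 L _ rfl h218)
                (hlim_toMuLim_of_origin C hC hS hl hp2 hpl hζ mods f hf hmods h15 L hO hYcl)).cohEnv.lim) ∧
        (∀ (g : Pi C) (u : (PadicAlgCl p)ˣ),
          h1LimKummer (phi C) (D.lDeltaTheta l) (PiYdd C) c (isOpen_stabilizer_units C) (finiteIndex_stabilizer_units C)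
              (g • u) =
            h1LimConjMulAut (phi C) (D.lDeltaTheta l) (PiYdd C) g
              (h1LimKummer (phi C) (D.lDeltaTheta l) (PiYdd C) c (isOpen_stabilizer_units C)
                (finiteIndex_stabilizer_units C) u)) ∧
        (∀ O : Submonoid (PadicAlgCl p)ˣ,
          (∀ (σ : GQp p) (u : (PadicAlgCl p)ˣ), u ∈ O → Units.map (σ : PadicAlgCl p →* PadicAlgCl p) u ∈ O) →
            ∀ (g : Pi C) (y : Multiplicative (h1Lim (phi C) (D.lDeltaTheta l) (PiYdd C) ⊥)),
              y ∈ O.map (h1LimKummer (phi C) (D.lDeltaTheta l) (PiYdd C) c (isOpen_stabilizer_units C)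
                (finiteIndex_stabilizer_units C)) →
              h1LimConjMulAut (phi C) (D.lDeltaTheta l) (PiYdd C) g y ∈
                O.map (h1LimKummer (phi C) (D.lDeltaTheta l) (PiYdd C) c (isOpen_stabilizer_units C)
                  (finiteIndex_stabilizer_units C)))) :=
  prop15_iv_thetaEnvDataNatural_kummer_and_hull C hC hS hl hp2 hpl hζ mods f hf hmods h15 L
    (hZ_of_origin C hC hS hl mods h15 L hO hYcl) (piYddCharacteristic_of_cor218_i C (mods 1) hC hS h15 L _ rfl h218)
    (hlim_toMuLim_of_origin C hC hS hl hp2 hpl hζ mods f hf hmods h15 L hO hYcl) TK hKum hcc hO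
    (D.isCompact_deltaTheta_of_groupLevelData d hYcl)

end EtaleLevels

end Literature.IUT.HodgeArakelov

end
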